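import Mathlib
import Summits.Ventures.PercRepro2.ZMeanProof
import Summits.Ventures.PercRepro2.PendantRoot
import Summits.Ventures.PercRepro2.PocketTransport
import Summits.Ventures.PercRepro2.PocketBHK
import Summits.Ventures.PercRepro2.HMFPendantO
import Summits.Ventures.PercRepro2.HMFTwoRootMass
import Summits.Ventures.PercRepro2.StarGlue
import Summits.Ventures.PercRepro2.StarOEvents
import Summits.Ventures.PercRepro2.StarOProb

/-!
# The three-coin star at `a₃` (class O): the mean field `X̂`, part 1 (transport and cluster identities) (blind cell PercRepro2, night-1 g8;
NIGHT1-G8.md §4)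

`X̂ = Σ_W P(C(a₃) = W) termW(W)` over the coin outcomes: with the `o`-coin open every cluster of
`a₃` contains `o` and its term vanishes; with both root coins open the term vanishes; with every
coin closed the only row is `{a₃}` (the isolated term `termPD {a₃}`); with only `f₁` open the cluster
is `{a₃} ∪ C₁(a₁)` and the rows are the light rows of the star-closed law (`termW` is invariant
under removing the isolated `a₃` from the residual graph, `termW_erase_a3`); with only `f₂` open
the heavy rows.  Hence `X̂ = r̄ [ᾱβ̄ · termPD{a₃} + αβ̄ · Y_T′ + βᾱ · Y_T]` (`Xhat_star3`), the row
sums being those of `PocketBHK.mfT_le` at the star-zeroed weights.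
-/

namespace Summit.Ventures.PercRepro2

open StarGlue PendantRoot UnionCluster

namespace StarO

section Xhat

variable {V : Type*} {E : Type*} [Fintype E] [DecidableEq E] [Fintype V] [DecidableEq V]
  {R : Type*} [Field R] [LinearOrder R] [IsStrictOrderedRing R]

variable (p : E → R) (ends : E → Sym2 V) {f₁ f₂ f₃ : E} {a₃ a₁ a₂ o b : V}

omit [Fintype E] [DecidableEq E] [Fintype V] [LinearOrder R] [IsStrictOrderedRing R] in
/-- Membership in `touches` of an insertion. -/
lemma mem_touches_insert (W : Finset V) (x : V) (e : E) :
    e ∈ touches ends (↑(insert x W) : Set V) ↔ e ∈ touches ends {x} ∨ e ∈ touches ends (↑W : Set V) := by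
  simp only [mem_touches, Finset.coe_insert, Set.mem_insert_iff, Finset.mem_coe,
    Set.mem_singleton_iff]
  constructor
  · rintro ⟨y, hy | hy, z, hz⟩
    · exact Or.inl ⟨y, hy, z, hz⟩
    · exact Or.inr ⟨y, hy, z, hz⟩
  · rintro (⟨y, hy, z, hz⟩ | ⟨y, hy, z, hz⟩)
    · exact ⟨y, Or.inl hy, z, hz⟩
    · exact ⟨y, Or.inr hy, z, hz⟩

omit [LinearOrder R] [IsStrictOrderedRing R] in
/-- Removing `insert a₃ W` from `ω` is removing `W` from the star-closed configuration. -/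
lemma restrict_insert_eq (W : Finset V) (ω : Config E) :
    restrict (touches ends (↑(insert a₃ W) : Set V))ᶜ ω =
      restrict (touches ends (↑W : Set V))ᶜ (PocketConn.closeOn (touches ends {a₃}).toFinset ω) := by
  rw [PocketConn.closeOn_eq_restrict]
  funext e
  by_cases h3 : e ∈ touches ends {a₃}
  · have h1 : e ∉ (touches ends (↑(insert a₃ W) : Set V))ᶜ := fun h =>
      h ((mem_touches_insert ends W a₃ e).2 (Or.inl h3))
    have h2 : e ∉ (↑(touches ends {a₃}).toFinset : Set E)ᶜ := fun h => h (by simpa using h3)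
    rw [restrict_apply_of_notMem h1]
    by_cases hW : e ∈ touches ends (↑W : Set V)
    · rw [restrict_apply_of_notMem (show e ∉ (touches ends (↑W : Set V))ᶜ from fun h => h hW)]
    · rw [restrict_apply_of_mem (show e ∈ (touches ends (↑W : Set V))ᶜ from hW),
        restrict_apply_of_notMem h2]
  · have h2 : e ∈ (↑(touches ends {a₃}).toFinset : Set E)ᶜ := fun h => h3 (by simpa using h)
    by_cases hW : e ∈ touches ends (↑W : Set V)
    · rw [restrict_apply_of_notMem (show e ∉ (touches ends (↑(insert a₃ W) : Set V))ᶜ from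
          fun h => h ((mem_touches_insert ends W a₃ e).2 (Or.inr hW))),
        restrict_apply_of_notMem (show e ∉ (touches ends (↑W : Set V))ᶜ from fun h => h hW)]
    · rw [restrict_apply_of_mem (show e ∈ (touches ends (↑(insert a₃ W) : Set V))ᶜ from
          fun h => ((mem_touches_insert ends W a₃ e).1 h).elim h3 hW),
        restrict_apply_of_mem (show e ∈ (touches ends (↑W : Set V))ᶜ from hW),
        restrict_apply_of_mem h2]

omit [LinearOrder R] [IsStrictOrderedRing R] in
/-- **Invisibility of the isolated `a₃` in the residual graph**: a residual event of
`G ∖ insert a₃ W` under `p` is the residual event of `G ∖ W` under the star-zeroed weights. -/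
lemma prob_resid_insert (W : Finset V) (β : Config E → Prop) :
    prob p {ω | β (restrict (touches ends (↑(insert a₃ W) : Set V))ᶜ ω)} =
      prob (pOut p ends a₃) {ω | β (restrict (touches ends (↑W : Set V))ᶜ ω)} := by
  unfold pOut
  rw [PocketConn.prob_zeroOn]
  congr 1
  ext ω
  simp only [Set.mem_setOf_eq, restrict_insert_eq]

omit [LinearOrder R] [IsStrictOrderedRing R] in
/-- `delConnProb` does not see the isolated `a₃`. -/
lemma delConnProb_insert_a3 (W : Finset V) (x : V) {v : V} (hv : v ≠ a₃) :
    delConnProb p ends (insert a₃ W) x v = delConnProb (pOut p ends a₃) ends W x v := by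
  unfold delConnProb
  have hmem : v ∈ insert a₃ W ↔ v ∈ W := by
    rw [Finset.mem_insert]
    exact ⟨fun h => h.resolve_left hv, Or.inr⟩
  by_cases hvW : v ∈ W
  · rw [if_pos (hmem.2 hvW), if_pos hvW]
  · rw [if_neg (fun h => hvW (hmem.1 h)), if_neg hvW]
    exact prob_resid_insert p ends W (fun ω' => Conn ends ω' x v)

omit [LinearOrder R] [IsStrictOrderedRing R] in
/-- `delShareMass` does not see the isolated `a₃`. -/
lemma delShareMass_insert_a3 (W : Finset V) (x : V) {v : V} (hv : v ≠ a₃) :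
    delShareMass p ends (insert a₃ W) a₁ a₂ x v = delShareMass (pOut p ends a₃) ends W a₁ a₂ x v := by
  unfold delShareMass
  have hmem : v ∈ insert a₃ W ↔ v ∈ W := by
    rw [Finset.mem_insert]
    exact ⟨fun h => h.resolve_left hv, Or.inr⟩
  by_cases hvW : v ∈ W
  · rw [if_pos (hmem.2 hvW), if_pos hvW]
  · rw [if_neg (fun h => hvW (hmem.1 h)), if_neg hvW]
    exact prob_resid_insert p ends W
      (fun ω' => ¬ Conn ends ω' a₁ a₂ ∧ Conn ends ω' x v)

omit [LinearOrder R] [IsStrictOrderedRing R] in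
/-- `P(Q in G ∖ ·)` does not see the isolated `a₃`. -/
lemma prob_delQ_insert_a3 (W : Finset V) :
    prob p (delQ ends (insert a₃ W) a₁ a₂) = prob (pOut p ends a₃) (delQ ends W a₁ a₂) :=
  prob_resid_insert p ends W (fun ω' => ¬ Conn ends ω' a₁ a₂)

omit [LinearOrder R] [IsStrictOrderedRing R] in
/-- **`termW` does not see the isolated `a₃`**: for `W ∌ a₃`,
`termW_p(insert a₃ W) = termW_{pOut}(W)`. -/
lemma termW_insert_a3 (W : Finset V) (h31 : a₃ ≠ a₁) (h32 : a₃ ≠ a₂) (h3o : a₃ ≠ o)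
    (h3b : a₃ ≠ b) :
    termW p ends o a₁ a₂ b (insert a₃ W) = termW (pOut p ends a₃) ends o a₁ a₂ b W := by
  have m1 : a₁ ∈ insert a₃ W ↔ a₁ ∈ W := by
    rw [Finset.mem_insert]; exact ⟨fun h => h.resolve_left h31.symm, Or.inr⟩
  have m2 : a₂ ∈ insert a₃ W ↔ a₂ ∈ W := by
    rw [Finset.mem_insert]; exact ⟨fun h => h.resolve_left h32.symm, Or.inr⟩
  have mb : b ∈ insert a₃ W ↔ b ∈ W := by
    rw [Finset.mem_insert]; exact ⟨fun h => h.resolve_left h3b.symm, Or.inr⟩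
  unfold termW termT termPD
  simp only [m1, m2, mb, delConnProb_insert_a3 p ends W _ h3o.symm,
    delConnProb_insert_a3 p ends W _ h3b.symm, delShareMass_insert_a3 p ends W _ h3o.symm,
    delShareMass_insert_a3 p ends W _ h3b.symm, prob_delQ_insert_a3 p ends W]

omit [Fintype E] [DecidableEq E] [Fintype V] [DecidableEq V] in
/-- With the `o`-coin open, `o` lies in the cluster of `a₃`: rows avoiding `o` are empty. -/
lemma clusterEvent_a3_inter_outc_f3 (hf₃ : ends f₃ = s(a₃, o)) {W : Finset V} (hoW : o ∉ W)
    (b₁ b₂ : Bool) :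
    clusterEvent ends a₃ (↑W : Set V) ∩ outc f₁ f₂ f₃ b₁ b₂ true = ∅ := by
  ext ω
  simp only [Set.mem_inter_iff, mem_clusterEvent, mem_outc, Set.mem_empty_iff_false, iff_false,
    not_and]
  intro hW _ _ h3
  apply hoW
  have : o ∈ cluster ends ω a₃ := conn_a3_o_of_f3 hf₃ h3
  rw [hW] at this
  exact Finset.mem_coe.1 this

omit [Fintype E] [DecidableEq E] [Fintype V] [DecidableEq V] in
/-- With both root coins open, both roots lie in the cluster of `a₃`. -/
lemma clusterEvent_a3_inter_outc_f12 (hf₁ : ends f₁ = s(a₃, a₁)) (hf₂ : ends f₂ = s(a₃, a₂))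
    {W : Finset V} (h : ¬ (a₁ ∈ W ∧ a₂ ∈ W)) (b₃ : Bool) :
    clusterEvent ends a₃ (↑W : Set V) ∩ outc f₁ f₂ f₃ true true b₃ = ∅ := by
  ext ω
  simp only [Set.mem_inter_iff, mem_clusterEvent, mem_outc, Set.mem_empty_iff_false, iff_false,
    not_and]
  intro hW h1 h2 _
  apply h
  have e1 : a₁ ∈ cluster ends ω a₃ := conn_of_openAdj ⟨f₁, h1, hf₁⟩
  have e2 : a₂ ∈ cluster ends ω a₃ := conn_of_openAdj ⟨f₂, h2, hf₂⟩
  rw [hW] at e1 e2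
  exact ⟨Finset.mem_coe.1 e1, Finset.mem_coe.1 e2⟩

omit [Fintype E] [DecidableEq E] in
/-- With every coin closed the cluster of `a₃` is `{a₃}`. -/
lemma clusterEvent_a3_inter_outc_ccc (hf₁ : ends f₁ = s(a₃, a₁)) (hf₂ : ends f₂ = s(a₃, a₂))
    (hf₃ : ends f₃ = s(a₃, o)) (hstar : ∀ e, a₃ ∈ ends e → e = f₁ ∨ e = f₂ ∨ e = f₃)
    (h31 : a₃ ≠ a₁) (h32 : a₃ ≠ a₂) (h3o : a₃ ≠ o) (W : Finset V) :
    clusterEvent ends a₃ (↑W : Set V) ∩ outc f₁ f₂ f₃ false false false =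
      if W = {a₃} then outc f₁ f₂ f₃ false false false else ∅ := by
  have hcl : ∀ ω : Config E, ω f₁ = false → ω f₂ = false → ω f₃ = false →
      cluster ends ω a₃ = {a₃} := by
    intro ω h1 h2 h3
    ext y
    simp only [mem_cluster, Set.mem_singleton_iff]
    constructor
    · intro h
      by_contra hy
      exact not_conn_a3_ccc hf₁ hf₂ hf₃ hstar h31 h32 h3o h1 h2 h3 hy h
    · rintro rfl; exact conn_refl _ _ _
  ext ω
  split_ifs with hW
  · subst hW
    simp only [Set.mem_inter_iff, mem_clusterEvent, mem_outc, Finset.coe_singleton,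
      and_iff_right_iff_imp]
    rintro ⟨h1, h2, h3⟩
    exact hcl ω h1 h2 h3
  · simp only [Set.mem_inter_iff, mem_clusterEvent, mem_outc, Set.mem_empty_iff_false, iff_false,
      not_and]
    intro h h1 h2 h3
    apply hW
    rw [hcl ω h1 h2 h3] at h
    exact Finset.coe_injective (by rw [Finset.coe_singleton]; exact h.symm)

omit [Fintype E] [DecidableEq E] in
/-- With only `f₁` open the cluster of `a₃` is `a₃` together with the star-closed cluster of `a₁`. -/
lemma clusterEvent_a3_inter_outc_f1 (hf₁ : ends f₁ = s(a₃, a₁)) (hf₂ : ends f₂ = s(a₃, a₂))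
    (hf₃ : ends f₃ = s(a₃, o)) (hstar : ∀ e, a₃ ∈ ends e → e = f₁ ∨ e = f₂ ∨ e = f₃)
    (h31 : a₃ ≠ a₁) (h32 : a₃ ≠ a₂) (h3o : a₃ ≠ o) (W : Finset V) :
    clusterEvent ends a₃ (↑W : Set V) ∩ outc f₁ f₂ f₃ true false false =
      if a₃ ∈ W then
        viaStar ends a₃ (clusterEvent ends a₁ (↑(W.erase a₃) : Set V)) ∩ outc f₁ f₂ f₃ true false false
      else ∅ := by
  have hcl : ∀ ω : Config E, ω f₁ = true → ω f₂ = false → ω f₃ = false →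
      cluster ends ω a₃ = insert a₃ (cluster ends (closeStar ends a₃ ω) a₁) := by
    intro ω h1 h2 h3
    ext y
    simp only [mem_cluster, Set.mem_insert_iff]
    by_cases hy : y = a₃
    · subst hy; simp [conn_refl]
    · rw [conn_a3_iff_f1 hf₁ hf₂ hf₃ hstar h31 h32 h3o h1 h2 h3 hy]
      exact ⟨Or.inr, fun h => h.resolve_left hy⟩
  have hnot : ∀ ω : Config E, a₃ ∉ cluster ends (closeStar ends a₃ ω) a₁ := fun ω h =>
    not_conn_closeStar h31.symm h
  ext ω
  split_ifs with hW
  · simp only [Set.mem_inter_iff, mem_clusterEvent, mem_outc, viaStar, Set.mem_setOf_eq,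
      and_congr_left_iff]
    rintro ⟨h1, h2, h3⟩
    rw [hcl ω h1 h2 h3]
    constructor
    · intro h
      ext y
      simp only [Finset.coe_erase, Set.mem_sdiff, Set.mem_singleton_iff]
      constructor
      · intro hy
        refine ⟨?_, fun hy3 => hnot ω (hy3 ▸ hy)⟩
        rw [← h]; exact Set.mem_insert_of_mem _ hy
      · rintro ⟨hy, hy3⟩
        rw [← h] at hy
        exact (Set.mem_insert_iff.1 hy).resolve_left hy3
    · intro h
      rw [h, Finset.coe_erase, Set.insert_sdiff_singleton, Set.insert_eq_of_mem (Finset.mem_coe.2 hW)]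
  · simp only [Set.mem_inter_iff, mem_clusterEvent, mem_outc, Set.mem_empty_iff_false, iff_false,
      not_and]
    intro h h1 h2 h3
    apply hW
    rw [hcl ω h1 h2 h3] at h
    rw [← Finset.mem_coe, ← h]
    exact Set.mem_insert _ _

omit [Fintype E] [DecidableEq E] in
/-- With only `f₂` open the cluster of `a₃` is `a₃` together with the star-closed cluster of `a₂`. -/
lemma clusterEvent_a3_inter_outc_f2 (hf₁ : ends f₁ = s(a₃, a₁)) (hf₂ : ends f₂ = s(a₃, a₂))
    (hf₃ : ends f₃ = s(a₃, o)) (hstar : ∀ e, a₃ ∈ ends e → e = f₁ ∨ e = f₂ ∨ e = f₃)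
    (h31 : a₃ ≠ a₁) (h32 : a₃ ≠ a₂) (h3o : a₃ ≠ o) (W : Finset V) :
    clusterEvent ends a₃ (↑W : Set V) ∩ outc f₁ f₂ f₃ false true false =
      if a₃ ∈ W then
        viaStar ends a₃ (clusterEvent ends a₂ (↑(W.erase a₃) : Set V)) ∩ outc f₁ f₂ f₃ false true false
      else ∅ := by
  have hcl : ∀ ω : Config E, ω f₁ = false → ω f₂ = true → ω f₃ = false →
      cluster ends ω a₃ = insert a₃ (cluster ends (closeStar ends a₃ ω) a₂) := by
    intro ω h1 h2 h3
    ext y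
    simp only [mem_cluster, Set.mem_insert_iff]
    by_cases hy : y = a₃
    · subst hy; simp [conn_refl]
    · rw [conn_a3_iff_f2 hf₁ hf₂ hf₃ hstar h31 h32 h3o h1 h2 h3 hy]
      exact ⟨Or.inr, fun h => h.resolve_left hy⟩
  have hnot : ∀ ω : Config E, a₃ ∉ cluster ends (closeStar ends a₃ ω) a₂ := fun ω h =>
    not_conn_closeStar h32.symm h
  ext ω
  split_ifs with hW
  · simp only [Set.mem_inter_iff, mem_clusterEvent, mem_outc, viaStar, Set.mem_setOf_eq,
      and_congr_left_iff]
    rintro ⟨h1, h2, h3⟩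
    rw [hcl ω h1 h2 h3]
    constructor
    · intro h
      ext y
      simp only [Finset.coe_erase, Set.mem_sdiff, Set.mem_singleton_iff]
      constructor
      · intro hy
        refine ⟨?_, fun hy3 => hnot ω (hy3 ▸ hy)⟩
        rw [← h]; exact Set.mem_insert_of_mem _ hy
      · rintro ⟨hy, hy3⟩
        rw [← h] at hy
        exact (Set.mem_insert_iff.1 hy).resolve_left hy3
    · intro h
      rw [h, Finset.coe_erase, Set.insert_sdiff_singleton, Set.insert_eq_of_mem (Finset.mem_coe.2 hW)]
  · simp only [Set.mem_inter_iff, mem_clusterEvent, mem_outc, Set.mem_empty_iff_false, iff_false,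
      not_and]
    intro h h1 h2 h3
    apply hW
    rw [hcl ω h1 h2 h3] at h
    rw [← Finset.mem_coe, ← h]
    exact Set.mem_insert _ _



end Xhat

end StarO

end Summit.Ventures.PercRepro2
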